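import Summits.BirchSwinnertonDyer.BirchSwinnertonDyer.Theorems.BiquadraticEisensteinDescentHeegnerTwistCouplingInSupplySymbolicMonskyEvenDesignNoSevenDiag
import Summits.BirchSwinnertonDyer.BirchSwinnertonDyer.Theorems.BiquadraticEisensteinDescentHeegnerTwistCouplingInSupplySymbolicMonskyEvenDesignObstruction
import Summits.BirchSwinnertonDyer.BirchSwinnertonDyer.Theorems.BiquadraticEisensteinDescentHeegnerTwistCouplingInSupplySymbolicMonskyEvenDesignZeroSections
import Summits.BirchSwinnertonDyer.BirchSwinnertonDyer.Theorems.BiquadraticEisensteinDescentHeegnerTwistCouplingInSupplySymbolicMonskyEvenDesignClassesOneThree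
import HarnessLib

set_option linter.dupNamespace false -- `Summit.BirchSwinnertonDyer.BirchSwinnertonDyer.Theorems.…` (summit = sub)
set_option autoImplicit false

/-!
# Crux `HeegnerTwistCouplingInSupply` (stmt-BirchSwinnertonDyer-21381) — ALL EVEN bases with no prime `≡ 7 (mod 8)`:
# the even ONE-STAGE door is open EXACTLY when the vertical kernel pairs span `≤ τ₀` dimensions (design `δ = 1`, or `δ = 0` in the boundary case)

Route `BiquadraticEisensteinDescent` (cell `pub/bsd-wall`, width seat `bsd-wall-cm-bed-w3` g25; `--supports` 21381, helper). Sequel of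
`…SymbolicMonskyEvenDesignNoSeven` / `…EvenDesignNoSevenDiag` (w3 g25): on even bases with no prime `≡ 7 (mod 8)` the `0 × V` and diagonal
conditions of EVEN THEOREM A hold at `δ = 1`, so `δ = 1` works iff `dim (W_ev(1) ∩ V×0) = a₁ + 1 ≤ τ₀` (`a₁ := dim{(0,v) ∈ 𝒦_ev}`,
`τ₀ = (dim 𝒦_ev + 1)/2`). This file closes the gap `a₁ = τ₀` with the design `δ = 0` (when a prime `≡ 5 (mod 8)` is present; otherwise all classes are `1, 3 (mod 8)` and
`δ = 1` always works by the order-three symmetry of `…EvenDesignClassesOneThree`, p753061), so that on the WHOLE family of even bases with no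
prime `≡ 7 (mod 8)` the even one-stage door is characterised EXACTLY by the vertical obstruction number `a₁` of `…SymbolicMonskyEvenDesignObstruction` (p750799) —
«EVEN THEOREM U′» of memo EVEN-EXCEPTIONAL-CLASS-w3g24 §2 for the class family `{1, 3, 5} (mod 8)`:
* uses `…EvenDesignZeroSections` (w3 g25): legitimacy of `δ = 0`, `dim(W_ev(0) ∩ V×0) ≤ a₁` with a prime `≡ 5 (mod 8)`,
  `dim (W_ev(0) ∩ 0×V) ≤ dim (W_ev(1) ∩ 0×V) + 1`, `dim (W_ev(0) ∩ Δ) ≤ dim (W_ev(1) ∩ Δ)`; and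
  `finrank_evenPencil_one_inf_ker_snd_le_of_negTwo_eq` (classes `{1,3}`: `dim (W_ev(1) ∩ V×0) ≤ dim (W_ev(1) ∩ 0×V)` by the symmetry `θ`);
* ★★★ `exists_even_design_of_noSeven_of_vertical_le` (`a₁ ≤ τ₀` ⇒ `δ = 1` or `δ = 0` satisfies all hypotheses of EVEN THEOREM A: if `δ = 1`
  fails then `dim (W_ev(1) ∩ V×0) = τ₀ + 1`, so by disjointness `dim (W_ev(1) ∩ 0×V) ≤ τ₀ − 1` and the three sections of `W_ev(0)` are `≤ τ₀`);
* ★★★ `even_door_iff_of_noSeven` — EXACT DOOR: (∃ δ, τ with the five hypotheses of EVEN THEOREM A) ⟺ `a₁ ≤ τ₀` (⟹ = the vertical obstruction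
  `finrank_le_evenPencil_inf_ker_snd`); recipe form `exists_patternFree_even_design_of_noSeven_of_vertical_le` and the realisation door
  `exists_recipe_cruxOn_even_of_noSeven_of_vertical_le` (modulo Burungale–Tian).
Numerics (w3 g25 probe20.py, 6 000 bases of the family, K ≤ 10): `a₁ < τ₀` 5 519× (δ = 1 good in all), `a₁ = τ₀` 387× (δ = 0 good in all,
δ = 1 in none), `a₁ > τ₀` 94× (no δ). HONEST FRAMING: RUNG-LEVEL corner layer; `𝔽₂`-linear algebra attached to Monsky matrices
[cite: HeathBrown1994SelmerCongruentII, Appendix (Monsky), typescript p. 41 L20–L36]; instances need located primes (w4 layer) and the print input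
[cite: BurungaleTian2026, Thm. 1.1]; the crux as stated (C⁺), its registered stubs and BSD are NOT touched; nothing is closed. THEOREMS ONLY.
-/


namespace Summit.BirchSwinnertonDyer.BirchSwinnertonDyer.Theorems.SymbolicMonsky

section NoSevenDoorIff

open Module Matrix Literature.NumberTheory.EllipticCurves Literature.NumberTheory.EllipticCurves.HeathBrown1994
  Literature.NumberTheory.EllipticCurves.HeathBrown1994.Families
open Literature.NumberTheory.EllipticCurves.Rank1Residual

variable {k : ℕ} (base : SymbData (k + 1))

/-- **Classes `{1, 3}` only (`d = m`): the `V × 0` section of `W_ev(1)` is not larger than the `0 × V` section** — the order-three symmetry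
`θ(p) = (p.2, p.1 + p.2)` of `W_ev(1)` (`theta_mem_evenPencil_one_of_negTwo_eq`, p753061) maps `(v, 0) ↦ (0, v)`. With
`two_mul_finrank_evenPencil_one_inf_ker_fst_le_of_noSeven` this bounds the `V × 0` section by `τ₀` on that family.
[cite: HeathBrown1994SelmerCongruentII, Appendix (Monsky), typescript p. 41 L20–L36] -/
theorem finrank_evenPencil_one_inf_ker_snd_le_of_negTwo_eq (hmd : ∀ b, negTwo (base.cls b) = negNegOne (base.cls b))
    (hμ : (∑ b, bz (negNegOne (base.cls b))) = 1) :
    finrank (ZMod 2) ↥(base.evenPencil (fun _ => 1) ⊓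
        LinearMap.ker (LinearMap.snd (ZMod 2) (Fin (k + 1) → ZMod 2) (Fin (k + 1) → ZMod 2))) ≤
      finrank (ZMod 2) ↥(base.evenPencil (fun _ => 1) ⊓
        LinearMap.ker (LinearMap.fst (ZMod 2) (Fin (k + 1) → ZMod 2) (Fin (k + 1) → ZMod 2))) := by
  set e := LinearEquiv.prodComm (ZMod 2) (Fin (k + 1) → ZMod 2) (Fin (k + 1) → ZMod 2) with he
  have hle : (base.evenPencil (fun _ => 1) ⊓
      LinearMap.ker (LinearMap.snd (ZMod 2) (Fin (k + 1) → ZMod 2) (Fin (k + 1) → ZMod 2))).map e.toLinearMap ≤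
      base.evenPencil (fun _ => 1) ⊓ LinearMap.ker (LinearMap.fst (ZMod 2) (Fin (k + 1) → ZMod 2) (Fin (k + 1) → ZMod 2)) := by
    intro q hq
    obtain ⟨p, hp, rfl⟩ := Submodule.mem_map.1 hq
    obtain ⟨hpW, hp0⟩ := Submodule.mem_inf.1 hp
    rw [LinearMap.mem_ker, LinearMap.snd_apply] at hp0
    have hθ := theta_mem_evenPencil_one_of_negTwo_eq base hmd hμ hpW
    rw [hp0, add_zero] at hθ
    have hsw : e.toLinearMap p = (p.2, p.1) := by
      rw [LinearEquiv.coe_toLinearMap, he, LinearEquiv.prodComm_apply, Prod.swap]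
    rw [hsw, hp0]
    exact Submodule.mem_inf.2 ⟨hθ, by rw [LinearMap.mem_ker, LinearMap.fst_apply]⟩
  calc finrank (ZMod 2) ↥(base.evenPencil (fun _ => 1) ⊓
          LinearMap.ker (LinearMap.snd (ZMod 2) (Fin (k + 1) → ZMod 2) (Fin (k + 1) → ZMod 2)))
      = finrank (ZMod 2) ↥((base.evenPencil (fun _ => 1) ⊓
          LinearMap.ker (LinearMap.snd (ZMod 2) (Fin (k + 1) → ZMod 2) (Fin (k + 1) → ZMod 2))).map e.toLinearMap) :=
        LinearEquiv.finrank_eq (Submodule.equivMapOfInjective _ e.injective _)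
    _ ≤ _ := Submodule.finrank_mono hle

/-- ★★★ **EVEN THEOREM U′ on the family with no prime `≡ 7` and some prime `≡ 5 (mod 8)`: the design `δ ∈ {0, 1}`.** If the vertical kernel pairs
`(0, v) ∈ 𝒦_ev` span `≤ τ₀ = (dim 𝒦_ev + 1)/2` dimensions, then `δ = 1` or `δ = 0` satisfies all hypotheses of EVEN THEOREM A (legitimate; the
three plane sections of `W_ev(δ)` have dimension `≤ τ₀`). [cite: HeathBrown1994SelmerCongruentII, Appendix (Monsky), typescript p. 41 L20–L36] -/
theorem exists_even_design_of_noSeven_of_vertical_le_of_classFive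
    (h7 : ∀ b, negNegOne (base.cls b) = true → negTwo (base.cls b) = true) (hμ : (∑ b, bz (negNegOne (base.cls b))) = 1)
    (b₅ : Fin (k + 1)) (hb₅ : negTwo (base.cls b₅) = true) (hb₅' : negNegOne (base.cls b₅) = false)
    (ha1 : finrank (ZMod 2) ↥(base.evenVirtualKernel ⊓
      LinearMap.ker (LinearMap.fst (ZMod 2) (Fin (k + 1) → ZMod 2) (Fin (k + 1) → ZMod 2))) ≤
        (finrank (ZMod 2) ↥base.evenVirtualKernel + 1) / 2) :
    ∃ δ : Fin (k + 1) → ZMod 2,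
      ((δ, fun i => 1 + δ i) : (Fin (k + 1) → ZMod 2) × (Fin (k + 1) → ZMod 2)) ∉ base.evenVirtualKernel.map (base.evenTwist δ) ∧
      finrank (ZMod 2) ↥(base.evenPencil δ ⊓
        LinearMap.ker (LinearMap.snd (ZMod 2) (Fin (k + 1) → ZMod 2) (Fin (k + 1) → ZMod 2))) ≤
          (finrank (ZMod 2) ↥base.evenVirtualKernel + 1) / 2 ∧
      finrank (ZMod 2) ↥(base.evenPencil δ ⊓
        LinearMap.ker (LinearMap.fst (ZMod 2) (Fin (k + 1) → ZMod 2) (Fin (k + 1) → ZMod 2))) ≤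
          (finrank (ZMod 2) ↥base.evenVirtualKernel + 1) / 2 ∧
      finrank (ZMod 2) ↥(base.evenPencil δ ⊓ LinearMap.ker (LinearMap.fst (ZMod 2) (Fin (k + 1) → ZMod 2) (Fin (k + 1) → ZMod 2) +
        LinearMap.snd (ZMod 2) (Fin (k + 1) → ZMod 2) (Fin (k + 1) → ZMod 2))) ≤
          (finrank (ZMod 2) ↥base.evenVirtualKernel + 1) / 2 := by
  obtain ⟨r, hr⟩ := odd_finrank_evenVirtualKernel base hμ
  obtain ⟨b₀, hb₀⟩ : ∃ b₀, negNegOne (base.cls b₀) = true := by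
    obtain ⟨b₀, -, hb₀⟩ := Finset.exists_ne_zero_of_sum_ne_zero
      (by rw [hμ]; exact one_ne_zero : (∑ b, bz (negNegOne (base.cls b))) ≠ 0)
    refine ⟨b₀, ?_⟩
    cases h : negNegOne (base.cls b₀) with
    | true => rfl
    | false => rw [h] at hb₀; exact absurd (by decide : bz false = 0) hb₀
  have hC := two_mul_finrank_evenPencil_one_inf_ker_fst_le_of_noSeven base h7 hμ
  have hH := two_mul_finrank_evenPencil_one_inf_diag_le_of_noSeven base h7 hμ
  by_cases hA : finrank (ZMod 2) ↥(base.evenPencil (fun _ => 1) ⊓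
      LinearMap.ker (LinearMap.snd (ZMod 2) (Fin (k + 1) → ZMod 2) (Fin (k + 1) → ZMod 2))) ≤
        (finrank (ZMod 2) ↥base.evenVirtualKernel + 1) / 2
  · exact ⟨fun _ => 1, evenPencil_one_legit base b₀ hb₀, hA, by omega, by omega⟩
  · -- boundary case: `dim (W_ev(1) ∩ V×0) = τ₀ + 1`, so `dim (W_ev(1) ∩ 0×V) ≤ τ₀ - 1` by disjointness; use `δ = 0`
    have hCA : (base.evenPencil (fun _ => 1) ⊓ LinearMap.ker (LinearMap.fst (ZMod 2) (Fin (k + 1) → ZMod 2) (Fin (k + 1) → ZMod 2))) ⊓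
        (base.evenPencil (fun _ => 1) ⊓ LinearMap.ker (LinearMap.snd (ZMod 2) (Fin (k + 1) → ZMod 2) (Fin (k + 1) → ZMod 2))) = ⊥ := by
      rw [Submodule.eq_bot_iff]
      intro p hp
      obtain ⟨hpC, hpA⟩ := Submodule.mem_inf.1 hp
      have h1 : p.1 = 0 := by
        have := (Submodule.mem_inf.1 hpC).2
        rwa [LinearMap.mem_ker, LinearMap.fst_apply] at this
      have hp2 : p.2 = 0 := by
        have := (Submodule.mem_inf.1 hpA).2
        rwa [LinearMap.mem_ker, LinearMap.snd_apply] at this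
      exact Prod.ext h1 hp2
    have hsup : (base.evenPencil (fun _ => 1) ⊓ LinearMap.ker (LinearMap.fst (ZMod 2) (Fin (k + 1) → ZMod 2) (Fin (k + 1) → ZMod 2))) ⊔
        (base.evenPencil (fun _ => 1) ⊓ LinearMap.ker (LinearMap.snd (ZMod 2) (Fin (k + 1) → ZMod 2) (Fin (k + 1) → ZMod 2))) ≤
        base.evenPencil (fun _ => 1) := sup_le inf_le_left inf_le_left
    have hW : finrank (ZMod 2) ↥(base.evenPencil (fun _ => 1)) = finrank (ZMod 2) ↥base.evenVirtualKernel + 1 :=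
      finrank_evenPencil_eq base (fun _ => 1) (evenPencil_one_legit base b₀ hb₀)
    have hsum := Submodule.finrank_sup_add_finrank_inf_eq
      (base.evenPencil (fun _ => 1) ⊓ LinearMap.ker (LinearMap.fst (ZMod 2) (Fin (k + 1) → ZMod 2) (Fin (k + 1) → ZMod 2)))
      (base.evenPencil (fun _ => 1) ⊓ LinearMap.ker (LinearMap.snd (ZMod 2) (Fin (k + 1) → ZMod 2) (Fin (k + 1) → ZMod 2)))
    rw [hCA, finrank_bot, add_zero] at hsum
    have hmono := Submodule.finrank_mono hsup
    have h1' := evenPencil_zero_inf_ker_snd_le base b₅ hb₅ hb₅'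
    have h2' := finrank_evenPencil_zero_inf_ker_fst_le base
    have h3' := finrank_evenPencil_zero_inf_diag_le base hμ
    refine ⟨fun _ => 0, evenPencil_zero_legit base hμ b₅ hb₅, h1'.trans ha1, by omega, by omega⟩

/-- ★★★ **EVEN THEOREM U′ on ALL even bases with no prime `≡ 7 (mod 8)`: the design `δ ∈ {0, 1}`.** If the vertical kernel pairs
`(0, v) ∈ 𝒦_ev` span `≤ τ₀` dimensions, then `δ = 1` or `δ = 0` satisfies all hypotheses of EVEN THEOREM A. (With a prime `≡ 5 (mod 8)`:
`exists_even_design_of_noSeven_of_vertical_le_of_classFive`; otherwise all classes are `1, 3 (mod 8)` and `δ = 1` works by the order-three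
symmetry of `…EvenDesignClassesOneThree`, `finrank_evenPencil_one_inf_ker_snd_le_of_negTwo_eq`.)
[cite: HeathBrown1994SelmerCongruentII, Appendix (Monsky), typescript p. 41 L20–L36] -/
theorem exists_even_design_of_noSeven_of_vertical_le
    (h7 : ∀ b, negNegOne (base.cls b) = true → negTwo (base.cls b) = true) (hμ : (∑ b, bz (negNegOne (base.cls b))) = 1)
    (ha1 : finrank (ZMod 2) ↥(base.evenVirtualKernel ⊓
      LinearMap.ker (LinearMap.fst (ZMod 2) (Fin (k + 1) → ZMod 2) (Fin (k + 1) → ZMod 2))) ≤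
        (finrank (ZMod 2) ↥base.evenVirtualKernel + 1) / 2) :
    ∃ δ : Fin (k + 1) → ZMod 2,
      ((δ, fun i => 1 + δ i) : (Fin (k + 1) → ZMod 2) × (Fin (k + 1) → ZMod 2)) ∉ base.evenVirtualKernel.map (base.evenTwist δ) ∧
      finrank (ZMod 2) ↥(base.evenPencil δ ⊓
        LinearMap.ker (LinearMap.snd (ZMod 2) (Fin (k + 1) → ZMod 2) (Fin (k + 1) → ZMod 2))) ≤
          (finrank (ZMod 2) ↥base.evenVirtualKernel + 1) / 2 ∧
      finrank (ZMod 2) ↥(base.evenPencil δ ⊓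
        LinearMap.ker (LinearMap.fst (ZMod 2) (Fin (k + 1) → ZMod 2) (Fin (k + 1) → ZMod 2))) ≤
          (finrank (ZMod 2) ↥base.evenVirtualKernel + 1) / 2 ∧
      finrank (ZMod 2) ↥(base.evenPencil δ ⊓ LinearMap.ker (LinearMap.fst (ZMod 2) (Fin (k + 1) → ZMod 2) (Fin (k + 1) → ZMod 2) +
        LinearMap.snd (ZMod 2) (Fin (k + 1) → ZMod 2) (Fin (k + 1) → ZMod 2))) ≤
          (finrank (ZMod 2) ↥base.evenVirtualKernel + 1) / 2 := by
  by_cases h5 : ∃ b, negTwo (base.cls b) = true ∧ negNegOne (base.cls b) = false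
  · obtain ⟨b₅, hb₅, hb₅'⟩ := h5
    exact exists_even_design_of_noSeven_of_vertical_le_of_classFive base h7 hμ b₅ hb₅ hb₅' ha1
  · have hmd : ∀ b, negTwo (base.cls b) = negNegOne (base.cls b) := fun b => by
      cases hm : negNegOne (base.cls b) with
      | true => exact h7 b hm
      | false =>
        cases hd : negTwo (base.cls b) with
        | false => rfl
        | true => exact absurd ⟨b, hd, hm⟩ h5
    obtain ⟨r, hr⟩ := odd_finrank_evenVirtualKernel base hμ
    obtain ⟨b₀, hb₀⟩ : ∃ b₀, negNegOne (base.cls b₀) = true := by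
      obtain ⟨b₀, -, hb₀⟩ := Finset.exists_ne_zero_of_sum_ne_zero
        (by rw [hμ]; exact one_ne_zero : (∑ b, bz (negNegOne (base.cls b))) ≠ 0)
      refine ⟨b₀, ?_⟩
      cases h : negNegOne (base.cls b₀) with
      | true => rfl
      | false => rw [h] at hb₀; exact absurd (by decide : bz false = 0) hb₀
    have hC := two_mul_finrank_evenPencil_one_inf_ker_fst_le_of_noSeven base h7 hμ
    have hH := two_mul_finrank_evenPencil_one_inf_diag_le_of_noSeven base h7 hμ
    have hA := finrank_evenPencil_one_inf_ker_snd_le_of_negTwo_eq base hmd hμ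
    exact ⟨fun _ => 1, evenPencil_one_legit base b₀ hb₀, by omega, by omega, by omega⟩

/-- ★★★ **EXACT EVEN ONE-STAGE DOOR on ALL even bases with no prime `≡ 7 (mod 8)`.** SOME `(δ, τ)` satisfies the five
hypotheses of EVEN THEOREM A (`(δ, 1+δ) ∉ T_δ(𝒦_ev)`, `dim W_ev(δ) = 2τ`, the three plane bounds `≤ τ`) if and only if the vertical kernel pairs
`(0, v) ∈ 𝒦_ev` span at most `τ₀ = (dim 𝒦_ev + 1)/2` dimensions. (⟹: the vertical obstruction `finrank_le_evenPencil_inf_ker_snd`, p750799;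
⟸: `exists_even_design_of_noSeven_of_vertical_le`.) [cite: HeathBrown1994SelmerCongruentII, Appendix (Monsky), typescript p. 41 L20–L36] -/
theorem even_door_iff_of_noSeven
    (h7 : ∀ b, negNegOne (base.cls b) = true → negTwo (base.cls b) = true) (hμ : (∑ b, bz (negNegOne (base.cls b))) = 1) :
    (∃ (δ : Fin (k + 1) → ZMod 2) (τ : ℕ),
      ((δ, fun i => 1 + δ i) : (Fin (k + 1) → ZMod 2) × (Fin (k + 1) → ZMod 2)) ∉ base.evenVirtualKernel.map (base.evenTwist δ) ∧
      finrank (ZMod 2) ↥(base.evenPencil δ) = 2 * τ ∧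
      finrank (ZMod 2) ↥(base.evenPencil δ ⊓
        LinearMap.ker (LinearMap.snd (ZMod 2) (Fin (k + 1) → ZMod 2) (Fin (k + 1) → ZMod 2))) ≤ τ ∧
      finrank (ZMod 2) ↥(base.evenPencil δ ⊓
        LinearMap.ker (LinearMap.fst (ZMod 2) (Fin (k + 1) → ZMod 2) (Fin (k + 1) → ZMod 2))) ≤ τ ∧
      finrank (ZMod 2) ↥(base.evenPencil δ ⊓ LinearMap.ker (LinearMap.fst (ZMod 2) (Fin (k + 1) → ZMod 2) (Fin (k + 1) → ZMod 2) +
        LinearMap.snd (ZMod 2) (Fin (k + 1) → ZMod 2) (Fin (k + 1) → ZMod 2))) ≤ τ) ↔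
    finrank (ZMod 2) ↥(base.evenVirtualKernel ⊓
      LinearMap.ker (LinearMap.fst (ZMod 2) (Fin (k + 1) → ZMod 2) (Fin (k + 1) → ZMod 2))) ≤
        (finrank (ZMod 2) ↥base.evenVirtualKernel + 1) / 2 := by
  constructor
  · rintro ⟨δ, τ, hδ, hdim, h1, -, -⟩
    have hτ : τ = (finrank (ZMod 2) ↥base.evenVirtualKernel + 1) / 2 := by
      have e := finrank_evenPencil_eq base δ hδ
      rw [hdim] at e
      omega
    rw [← hτ]
    refine (finrank_le_evenPencil_inf_ker_snd base δ _ inf_le_left fun p hp => ?_).trans h1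
    exact (Submodule.mem_inf.1 hp).2
  · intro ha1
    obtain ⟨δ, hδ, h1, h2, h3⟩ := exists_even_design_of_noSeven_of_vertical_le base h7 hμ ha1
    obtain ⟨r, hr⟩ := odd_finrank_evenVirtualKernel base hμ
    refine ⟨δ, (finrank (ZMod 2) ↥base.evenVirtualKernel + 1) / 2, hδ, ?_, h1, h2, h3⟩
    rw [finrank_evenPencil_eq base δ hδ, hr]
    omega

/-- ★★★ **Recipe form.** On even bases with no prime `≡ 7 (mod 8)`, `a₁ ≤ τ₀` gives a pattern-free Heegner recipe with `τ₀ + 1` auxiliary primes (cells `c₁ :: rest`,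
`|rest| = τ₀`, `heegnerK`, Monsky's even matrix invertible for EVERY mutual pattern).
[cite: HeathBrown1994SelmerCongruentII, Appendix (Monsky), typescript p. 41 L20–L36] -/
theorem exists_patternFree_even_design_of_noSeven_of_vertical_le
    (h7 : ∀ b, negNegOne (base.cls b) = true → negTwo (base.cls b) = true) (hμ : (∑ b, bz (negNegOne (base.cls b))) = 1)
    (ha1 : finrank (ZMod 2) ↥(base.evenVirtualKernel ⊓
      LinearMap.ker (LinearMap.fst (ZMod 2) (Fin (k + 1) → ZMod 2) (Fin (k + 1) → ZMod 2))) ≤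
        (finrank (ZMod 2) ↥base.evenVirtualKernel + 1) / 2) :
    ∃ (c₁ : AuxCell) (rest : List AuxCell), rest.length = (finrank (ZMod 2) ↥base.evenVirtualKernel + 1) / 2 ∧
      heegnerK base (c₁ :: rest) = true ∧ ∀ pat : ℕ → ℕ → Bool, (dataK base (c₁ :: rest) pat).monskyEvenS.det = 1 := by
  obtain ⟨δ, hδ, h1, h2, h3⟩ := exists_even_design_of_noSeven_of_vertical_le base h7 hμ ha1
  exact exists_patternFree_even_design_pencil_of_odd base hμ δ hδ h1 h2 h3

/-- ★★★ **The same through the realisation door**: on even bases with no prime `≡ 7 (mod 8)`, `a₁ ≤ τ₀` gives one cell list `aux` (`τ₀ + 1` cells, `heegnerK`) such that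
any realising primes in the size window give the conclusion of `HeegnerTwistCouplingInSupply` at `(E_{2n}, P₀)`, modulo Burungale–Tian.
[cite: HeathBrown1994SelmerCongruentII, Appendix (Monsky), typescript p. 41 L20–L36] [cite: BurungaleTian2026, Thm. 1.1]
[cite: Oesterle1988Gauss, II §3 Proposition p. 57 (27)] -/
theorem exists_recipe_cruxOn_even_of_noSeven_of_vertical_le
    (hBT : burungaleTian_analyticRank_eq_zero_of_selmerCorank_eq_zero_of_hasCM)
    (h7 : ∀ b, negNegOne (base.cls b) = true → negTwo (base.cls b) = true) (hμ : (∑ b, bz (negNegOne (base.cls b))) = 1)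
    (ha1 : finrank (ZMod 2) ↥(base.evenVirtualKernel ⊓
      LinearMap.ker (LinearMap.fst (ZMod 2) (Fin (k + 1) → ZMod 2) (Fin (k + 1) → ZMod 2))) ≤
        (finrank (ZMod 2) ↥base.evenVirtualKernel + 1) / 2) :
    ∃ aux : List AuxCell, aux.length = (finrank (ZMod 2) ↥base.evenVirtualKernel + 1) / 2 + 1 ∧ heegnerK base aux = true ∧
      ∀ (P : Fin (k + 1) → ℕ) (q : Fin aux.length → ℕ), RealisesK base aux P q →
        ∀ (n : ℕ) [(congruentNumberCurve (2 * n)).IsElliptic], (∏ b, P b) = n →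
          Real.sqrt ((∏ j, q j : ℕ) : ℝ) * Real.log ((∏ j, q j : ℕ) : ℝ) < Real.pi * P 0 →
          ∃ (K : Type) (_ : Field K) (_ : NumberField K),
            IsImaginaryQuadratic K ∧ 4 < (NumberField.discr K).natAbs ∧
            SatisfiesHeegnerHypothesis ((congruentNumberCurve (2 * n)).conductorNorm ℤ) K ∧
            ((congruentNumberCurve (2 * n)).quadraticTwist (NumberField.discr K : ℚ)).entireLFunction 1 ≠ 0 ∧
            ¬ P 0 ∣ NumberField.classNumber K := by
  obtain ⟨c₁, rest, hlen, hH, hdet⟩ := exists_patternFree_even_design_of_noSeven_of_vertical_le base h7 hμ ha1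
  refine ⟨c₁ :: rest, by simp [hlen], hH, ?_⟩
  intro P q hR n _ hn hsize
  exact hR.cruxOn_even_of_BT_of_forall hBT hH hdet hn hsize

end NoSevenDoorIff

end Summit.BirchSwinnertonDyer.BirchSwinnertonDyer.Theorems.SymbolicMonsky
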